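import Summits.CriticalPhenomena.Ising3DConformalLimit.Theses.CoerciveSharpness
import Summits.CriticalPhenomena.Ising3DConformalLimit.Theses.SynchronousCoupling
import Summits.CriticalPhenomena.Ising3DConformalLimit.Theses.ClusterRigidity
import Summits.CriticalPhenomena.Ising3DConformalLimit.Theses.HelsonAxis
import Literature.Probability.LatticeModels.PointwiseScalingLimitEtaExists
import Summits.CriticalPhenomena.Ising3DConformalLimit.Theorems.CoerciveSharpnessDimensionPinnedStubLowerEnvelope
import Summits.CriticalPhenomena.Ising3DConformalLimit.Theorems.CoerciveSharpnessDimensionPinnedStubOctaveTelescoping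
import Summits.CriticalPhenomena.Ising3DConformalLimit.Theorems.CoerciveSharpnessDimensionPinnedStubBlockVarianceBounds
import Summits.CriticalPhenomena.Ising3DConformalLimit.Theorems.CoerciveSharpnessDimensionPinnedStubLambdaRate
import Summits.CriticalPhenomena.Ising3DConformalLimit.Theorems.CoerciveSharpnessDimensionPinnedStubDock
import Summits.CriticalPhenomena.Ising3DConformalLimit.Theorems.CoerciveSharpnessDimensionPinnedPointwiseTransfer
import Summits.CriticalPhenomena.Ising3DConformalLimit.Theorems.CoerciveSharpnessDimensionPinnedVarianceTransfer
import Literature.Probability.LatticeModels.CriticalTwoPointBounds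
import HarnessLib

/-!
# Line `Sketch` (idea `octave-telescoping-block-dock`) for the crux `CoerciveSharpness.DimensionPinned`
(item stmt-CriticalPhenomena-4662; routes CoerciveSharpness / HelsonAxis / ClusterRigidity) — lead skeleton

The crux, verbatim: `DimensionPinned := ∃ η : ℝ, HasIsingEtaBounds 3 η`
(two-sided pure-power bounds `c‖x‖^{-(1+η)} ≤ ⟨σ₀σ_x⟩_{β_c(3)} ≤ C‖x‖^{-(1+η)}`, `x ≠ 0`, sup norm).

Notation used informally below (everything is WRITTEN OUT in the statements, no definitions):
`G := criticalTwoPoint 3`, `g n := G (n e₀)`, `Q_L := [0,L)³ ∩ ℤ³`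
(`Fintype.piFinset fun _ => Finset.Ico 0 L`), `Q_L(u) := L•u + Q_L`
(`Fintype.piFinset fun i => Finset.Ico (L * u i) (L * u i + L)`), block covariance
`C_L(u) := Σ_{x ∈ Q_L} Σ_{y ∈ Q_L(u)} G (y - x)`, block variance `V_L := C_L(0) = Σ_{x,y ∈ Q_L} G (y - x)`,
normalised covariance `R_L(u) := C_L(u) / V_L`, octave ratio `Λ_L := V_{2L} / V_L`.

## The line (Li–Shiraishi octave telescoping read on block variances; card `octave-telescoping-block-dock`)

* `stub_dilationCovarianceRate` — **the OPEN input C⁺ = DCR₂₇**: a power rate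
  `|R_{2L}(u) - R_L(u)| ≤ C L^{-θ}` for the 27 nearest displacements `u ∈ {-1,0,1}³`, `L ≥ 1`.
  Engines: `stub_dock` ∘ item stmt-CriticalPhenomena-18762 (`SynchronousCoupling.DilationJoinings`);
  any power-rate two-scale existence statement.  Not provable from profile facts (it implies doubling).
* `stub_lambdaRate` — DCR₂₇ ⟹ `8 ≤ Λ_L` and `|Λ_{2L} - Λ_L| ≤ C' L^{-θ}` (exact sub-block recursion
  `V_{2L} = Σ_{i,j ∈ {0,1}³} C_L(j - i)`, positivity of `G`).
* `stub_blockVarianceBounds` — a priori `c L⁴ ≤ V_L ≤ L⁶` (Simon–Lieb floor `G ≥ c‖x‖⁻²`, `G ≤ 1`) and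
  `L⁶ g(3L) ≤ V_L` (Messager–Miracle-Solé sandwich `G(z) ≥ g(3‖z‖_∞)`, antitonicity).
* `stub_octaveTelescoping` — pure real analysis: positive `v` with ratios `≥ m > 0` whose consecutive
  ratios differ by `≤ C 2^{-θk}` satisfy `A₁ Λ^k ≤ v k ≤ A₂ Λ^k` (geometric Cauchy + telescoping of logs).
* `stub_lowerEnvelope` — (hardest provable, held by the lead) from `A (2^k)^{6-s} ≤ V_{2^k}`, `0 ≤ s ≤ 2`,
  and the upper envelope `g n ≤ B n^{-s}`: the lower envelope `g n ≥ c n^{-s}`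
  (`V_L ≤ L³ Σ_{‖z‖∞ ≤ L} G`, shell peeling with MMS `G(z) ≤ g(‖z‖_∞)` and `sum_box_erase_norm_rpow_le`).
* `stub_dock` — `DilationJoinings → DCR₂₇` (plus measure `exists_plusMeasure_holds`, its pair
  correlations = `criticalTwoPoint 3`, Cauchy–Schwarz in `L²(π)`).
* `stub_transfer` — `DCR₂₇ → DimensionPinned`, PROVED HERE modulo the four analytic stubs
  (`DimensionPinned_of`: telescoping at `v k = V_{2^k}`, `Λ ∈ [16, 64]` from the a-priori bounds,
  `s := 6 - log₂ Λ ∈ [0, 2]`, upper envelope by dyadic fill-in, lower envelope by the stub, then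
  axis bounds ⟹ crux by the MMS sphere sandwich exactly as in `CensusWeb.dimensionPinned_of_axisPinned`).

`DimensionPinned_proof : DimensionPinned := stub_transfer stub_dilationCovarianceRate` and
`DimensionPinned_of_dilationJoinings : DilationJoinings → DimensionPinned` (through `stub_dock`).

STATUS (cycle 1, 2026-08-17): stubs 2–7 and the pointwise port LANDED under
`Theorems/CoerciveSharpnessDimensionPinned{StubLambdaRate,StubBlockVarianceBounds,StubOctaveTelescoping,
StubLowerEnvelope,StubDock,Transfer,PointwiseTransfer,VarianceTransfer}.lean`
(p161825 p161616 p161535 p161367 p161817 p162260 p162779 p163212);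
the ONLY `sorry` left is `stub_dilationCovarianceRate` (DCR₂₇), the open input.
-/

noncomputable section

namespace Summit.CriticalPhenomena.Ising3DConformalLimit.Cruxes.DimensionPinned.OctaveTelescoping

open scoped BigOperators
open Filter Topology Finset
open Literature.Probability.LatticeModels
open Summit.CriticalPhenomena.Ising3DConformalLimit.Theses.CoerciveSharpness (DimensionPinned)
open Summit.CriticalPhenomena.Ising3DConformalLimit.Theses.SynchronousCoupling (DilationJoinings)

/-! ### The registered stubs -/

/-- **stub 1 — DCR₂₇, the open input of the line.** Power-rate Cauchy property of the 27 nearest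
normalised block covariances of `criticalTwoPoint 3` under `L ↦ 2L`. -/
theorem stub_dilationCovarianceRate :
    ∃ θ C : ℝ, 0 < θ ∧ ∀ L : ℕ, 1 ≤ L → ∀ u : Fin 3 → ℤ, (∀ i, |u i| ≤ 1) →
      |(∑ x ∈ Fintype.piFinset (fun _ : Fin 3 => Finset.Ico (0:ℤ) (2 * (L:ℤ))),
          ∑ y ∈ Fintype.piFinset (fun i : Fin 3 => Finset.Ico (2 * (L:ℤ) * u i) (2 * (L:ℤ) * u i + 2 * (L:ℤ))),
            criticalTwoPoint 3 (y - x)) /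
        (∑ x ∈ Fintype.piFinset (fun _ : Fin 3 => Finset.Ico (0:ℤ) (2 * (L:ℤ))),
          ∑ y ∈ Fintype.piFinset (fun _ : Fin 3 => Finset.Ico (0:ℤ) (2 * (L:ℤ))), criticalTwoPoint 3 (y - x)) -
       (∑ x ∈ Fintype.piFinset (fun _ : Fin 3 => Finset.Ico (0:ℤ) (L:ℤ)),
          ∑ y ∈ Fintype.piFinset (fun i : Fin 3 => Finset.Ico ((L:ℤ) * u i) ((L:ℤ) * u i + (L:ℤ))),
            criticalTwoPoint 3 (y - x)) /
        (∑ x ∈ Fintype.piFinset (fun _ : Fin 3 => Finset.Ico (0:ℤ) (L:ℤ)),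
          ∑ y ∈ Fintype.piFinset (fun _ : Fin 3 => Finset.Ico (0:ℤ) (L:ℤ)), criticalTwoPoint 3 (y - x))|
      ≤ C * (L : ℝ) ^ (-θ) := by
  sorry

/-- **stub 2 — DCR₂₇ gives a power rate for the octave ratio of block variances.**
`8 ≤ V_{2L}/V_L` and `|V_{4L}/V_{2L} - V_{2L}/V_L| ≤ C' L^{-θ}` (`L ≥ 1`), via the exact sub-block
recursion `V_{2L} = Σ_{i,j ∈ {0,1}³} C_L(j-i)` and `G > 0`. -/
theorem stub_lambdaRate :
    (∃ θ C : ℝ, 0 < θ ∧ ∀ L : ℕ, 1 ≤ L → ∀ u : Fin 3 → ℤ, (∀ i, |u i| ≤ 1) →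
      |(∑ x ∈ Fintype.piFinset (fun _ : Fin 3 => Finset.Ico (0:ℤ) (2 * (L:ℤ))),
          ∑ y ∈ Fintype.piFinset (fun i : Fin 3 => Finset.Ico (2 * (L:ℤ) * u i) (2 * (L:ℤ) * u i + 2 * (L:ℤ))),
            criticalTwoPoint 3 (y - x)) /
        (∑ x ∈ Fintype.piFinset (fun _ : Fin 3 => Finset.Ico (0:ℤ) (2 * (L:ℤ))),
          ∑ y ∈ Fintype.piFinset (fun _ : Fin 3 => Finset.Ico (0:ℤ) (2 * (L:ℤ))), criticalTwoPoint 3 (y - x)) -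
       (∑ x ∈ Fintype.piFinset (fun _ : Fin 3 => Finset.Ico (0:ℤ) (L:ℤ)),
          ∑ y ∈ Fintype.piFinset (fun i : Fin 3 => Finset.Ico ((L:ℤ) * u i) ((L:ℤ) * u i + (L:ℤ))),
            criticalTwoPoint 3 (y - x)) /
        (∑ x ∈ Fintype.piFinset (fun _ : Fin 3 => Finset.Ico (0:ℤ) (L:ℤ)),
          ∑ y ∈ Fintype.piFinset (fun _ : Fin 3 => Finset.Ico (0:ℤ) (L:ℤ)), criticalTwoPoint 3 (y - x))|
      ≤ C * (L : ℝ) ^ (-θ)) →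
    ∃ θ C : ℝ, 0 < θ ∧ ∀ L : ℕ, 1 ≤ L →
      8 ≤ (∑ x ∈ Fintype.piFinset (fun _ : Fin 3 => Finset.Ico (0:ℤ) (2 * (L:ℤ))),
              ∑ y ∈ Fintype.piFinset (fun _ : Fin 3 => Finset.Ico (0:ℤ) (2 * (L:ℤ))), criticalTwoPoint 3 (y - x)) /
            (∑ x ∈ Fintype.piFinset (fun _ : Fin 3 => Finset.Ico (0:ℤ) (L:ℤ)),
              ∑ y ∈ Fintype.piFinset (fun _ : Fin 3 => Finset.Ico (0:ℤ) (L:ℤ)), criticalTwoPoint 3 (y - x)) ∧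
      |(∑ x ∈ Fintype.piFinset (fun _ : Fin 3 => Finset.Ico (0:ℤ) (4 * (L:ℤ))),
          ∑ y ∈ Fintype.piFinset (fun _ : Fin 3 => Finset.Ico (0:ℤ) (4 * (L:ℤ))), criticalTwoPoint 3 (y - x)) /
        (∑ x ∈ Fintype.piFinset (fun _ : Fin 3 => Finset.Ico (0:ℤ) (2 * (L:ℤ))),
          ∑ y ∈ Fintype.piFinset (fun _ : Fin 3 => Finset.Ico (0:ℤ) (2 * (L:ℤ))), criticalTwoPoint 3 (y - x)) -
       (∑ x ∈ Fintype.piFinset (fun _ : Fin 3 => Finset.Ico (0:ℤ) (2 * (L:ℤ))),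
          ∑ y ∈ Fintype.piFinset (fun _ : Fin 3 => Finset.Ico (0:ℤ) (2 * (L:ℤ))), criticalTwoPoint 3 (y - x)) /
        (∑ x ∈ Fintype.piFinset (fun _ : Fin 3 => Finset.Ico (0:ℤ) (L:ℤ)),
          ∑ y ∈ Fintype.piFinset (fun _ : Fin 3 => Finset.Ico (0:ℤ) (L:ℤ)), criticalTwoPoint 3 (y - x))|
      ≤ C * (L : ℝ) ^ (-θ) :=
  -- LANDED: p161825 (Theorems/CoerciveSharpnessDimensionPinnedStubLambdaRate.lean)
  Summit.CriticalPhenomena.Ising3DConformalLimit.Theorems.CoerciveSharpnessDimensionPinned.stub_lambdaRate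

/-- **stub 3 — a priori block-variance bounds.** `c L⁴ ≤ V_L ≤ L⁶` and `L⁶ g(3L) ≤ V_L` for `L ≥ 1`
(Simon–Lieb floor and `G ≤ 1` from `criticalTwoPoint_bounds_holds` / `criticalTwoPoint_le_one'`;
MMS sandwich `criticalTwoPoint_axis_sandwich` with `criticalTwoPoint_axis_antitone`, `G 0 = 1`). -/
theorem stub_blockVarianceBounds :
    ∃ c : ℝ, 0 < c ∧ ∀ L : ℕ, 1 ≤ L →
      c * (L : ℝ) ^ 4 ≤
          (∑ x ∈ Fintype.piFinset (fun _ : Fin 3 => Finset.Ico (0:ℤ) (L:ℤ)),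
            ∑ y ∈ Fintype.piFinset (fun _ : Fin 3 => Finset.Ico (0:ℤ) (L:ℤ)), criticalTwoPoint 3 (y - x)) ∧
        (∑ x ∈ Fintype.piFinset (fun _ : Fin 3 => Finset.Ico (0:ℤ) (L:ℤ)),
            ∑ y ∈ Fintype.piFinset (fun _ : Fin 3 => Finset.Ico (0:ℤ) (L:ℤ)), criticalTwoPoint 3 (y - x)) ≤
          (L : ℝ) ^ 6 ∧
        (L : ℝ) ^ 6 * criticalTwoPoint 3 (Pi.single 0 ((3 * L : ℕ) : ℤ)) ≤
          (∑ x ∈ Fintype.piFinset (fun _ : Fin 3 => Finset.Ico (0:ℤ) (L:ℤ)),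
            ∑ y ∈ Fintype.piFinset (fun _ : Fin 3 => Finset.Ico (0:ℤ) (L:ℤ)), criticalTwoPoint 3 (y - x)) :=
  -- LANDED: p161616 (Theorems/CoerciveSharpnessDimensionPinnedStubBlockVarianceBounds.lean)
  Summit.CriticalPhenomena.Ising3DConformalLimit.Theorems.CoerciveSharpnessDimensionPinned.stub_blockVarianceBounds

/-- **stub 4 — octave telescoping (Li–Shiraishi's `b_n` trick), pure real analysis.** A positive
sequence whose consecutive ratios are `≥ m > 0` and differ by `≤ C 2^{-θk}` grows like `Λ^k` up to
constants, `Λ = lim v(k+1)/v(k) ≥ m`. -/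
theorem stub_octaveTelescoping :
    ∀ (v : ℕ → ℝ) (m θ C : ℝ), 0 < m → 0 < θ →
      (∀ k : ℕ, 0 < v k) → (∀ k : ℕ, m ≤ v (k + 1) / v k) →
      (∀ k : ℕ, |v (k + 2) / v (k + 1) - v (k + 1) / v k| ≤ C * ((2:ℝ) ^ k) ^ (-θ)) →
      ∃ Λ A₁ A₂ : ℝ, m ≤ Λ ∧ 0 < A₁ ∧ ∀ k : ℕ, A₁ * Λ ^ k ≤ v k ∧ v k ≤ A₂ * Λ ^ k :=
  -- LANDED: p161535 (Theorems/CoerciveSharpnessDimensionPinnedStubOctaveTelescoping.lean)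
  Summit.CriticalPhenomena.Ising3DConformalLimit.Theorems.CoerciveSharpnessDimensionPinned.stub_octaveTelescoping

/-- **stub 5 — the lower envelope from block-variance growth (lead's stub).** If
`A (2^k)^{6-s} ≤ V_{2^k}` for all `k` with `0 ≤ s ≤ 2`, `A > 0`, and `g n ≤ B n^{-s}` (`n ≥ 1`), then
`g n ≥ c n^{-s}` (`n ≥ 1`) for some `c > 0`. -/
theorem stub_lowerEnvelope :
    ∀ (s A B : ℝ), 0 ≤ s → s ≤ 2 → 0 < A →
      (∀ k : ℕ, A * ((2:ℝ) ^ k) ^ ((6:ℝ) - s) ≤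
        ∑ x ∈ Fintype.piFinset (fun _ : Fin 3 => Finset.Ico (0:ℤ) (2 ^ k)),
          ∑ y ∈ Fintype.piFinset (fun _ : Fin 3 => Finset.Ico (0:ℤ) (2 ^ k)), criticalTwoPoint 3 (y - x)) →
      (∀ n : ℕ, 1 ≤ n → criticalTwoPoint 3 (Pi.single 0 (n : ℤ)) ≤ B * (n : ℝ) ^ (-s)) →
      ∃ c : ℝ, 0 < c ∧ ∀ n : ℕ, 1 ≤ n → c * (n : ℝ) ^ (-s) ≤ criticalTwoPoint 3 (Pi.single 0 (n : ℤ)) :=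
  -- LANDED: p161367 (Theorems/CoerciveSharpnessDimensionPinnedStubLowerEnvelope.lean)
  Summit.CriticalPhenomena.Ising3DConformalLimit.Theorems.CoerciveSharpnessDimensionPinned.stub_lowerEnvelope

/-- **stub 6 — the dock: `DilationJoinings` (item stmt-CriticalPhenomena-18762) implies DCR₂₇.**
Take the plus measure at `β_c(3)` (`exists_plusMeasure_holds`: DLR, translation invariant, pair
correlations `= criticalTwoPoint 3`), the joining `π` at `p = 2`, `m = 1`, and Cauchy–Schwarz in `L²(π)`:
`|R_{2b}(u) - R_b(u)| ≤ ‖X_u - Y_u‖₂ + ‖X_0 - Y_0‖₂ ≤ 2√C b^{-θ/2}`. -/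
theorem stub_dock :
    DilationJoinings →
    ∃ θ C : ℝ, 0 < θ ∧ ∀ L : ℕ, 1 ≤ L → ∀ u : Fin 3 → ℤ, (∀ i, |u i| ≤ 1) →
      |(∑ x ∈ Fintype.piFinset (fun _ : Fin 3 => Finset.Ico (0:ℤ) (2 * (L:ℤ))),
          ∑ y ∈ Fintype.piFinset (fun i : Fin 3 => Finset.Ico (2 * (L:ℤ) * u i) (2 * (L:ℤ) * u i + 2 * (L:ℤ))),
            criticalTwoPoint 3 (y - x)) /
        (∑ x ∈ Fintype.piFinset (fun _ : Fin 3 => Finset.Ico (0:ℤ) (2 * (L:ℤ))),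
          ∑ y ∈ Fintype.piFinset (fun _ : Fin 3 => Finset.Ico (0:ℤ) (2 * (L:ℤ))), criticalTwoPoint 3 (y - x)) -
       (∑ x ∈ Fintype.piFinset (fun _ : Fin 3 => Finset.Ico (0:ℤ) (L:ℤ)),
          ∑ y ∈ Fintype.piFinset (fun i : Fin 3 => Finset.Ico ((L:ℤ) * u i) ((L:ℤ) * u i + (L:ℤ))),
            criticalTwoPoint 3 (y - x)) /
        (∑ x ∈ Fintype.piFinset (fun _ : Fin 3 => Finset.Ico (0:ℤ) (L:ℤ)),
          ∑ y ∈ Fintype.piFinset (fun _ : Fin 3 => Finset.Ico (0:ℤ) (L:ℤ)), criticalTwoPoint 3 (y - x))|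
      ≤ C * (L : ℝ) ^ (-θ) :=
  -- LANDED: p161817 (Theorems/CoerciveSharpnessDimensionPinnedStubDock.lean)
  Summit.CriticalPhenomena.Ising3DConformalLimit.Theorems.CoerciveSharpnessDimensionPinned.stub_dock

/-! ### Skeleton-local abbreviations of the stub statements (NOT registered; landed files write them out) -/

/-- Statement of `stub_dilationCovarianceRate` (DCR₂₇). -/
def DCR : Prop :=
    ∃ θ C : ℝ, 0 < θ ∧ ∀ L : ℕ, 1 ≤ L → ∀ u : Fin 3 → ℤ, (∀ i, |u i| ≤ 1) →
      |(∑ x ∈ Fintype.piFinset (fun _ : Fin 3 => Finset.Ico (0:ℤ) (2 * (L:ℤ))),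
          ∑ y ∈ Fintype.piFinset (fun i : Fin 3 => Finset.Ico (2 * (L:ℤ) * u i) (2 * (L:ℤ) * u i + 2 * (L:ℤ))),
            criticalTwoPoint 3 (y - x)) /
        (∑ x ∈ Fintype.piFinset (fun _ : Fin 3 => Finset.Ico (0:ℤ) (2 * (L:ℤ))),
          ∑ y ∈ Fintype.piFinset (fun _ : Fin 3 => Finset.Ico (0:ℤ) (2 * (L:ℤ))), criticalTwoPoint 3 (y - x)) -
       (∑ x ∈ Fintype.piFinset (fun _ : Fin 3 => Finset.Ico (0:ℤ) (L:ℤ)),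
          ∑ y ∈ Fintype.piFinset (fun i : Fin 3 => Finset.Ico ((L:ℤ) * u i) ((L:ℤ) * u i + (L:ℤ))),
            criticalTwoPoint 3 (y - x)) /
        (∑ x ∈ Fintype.piFinset (fun _ : Fin 3 => Finset.Ico (0:ℤ) (L:ℤ)),
          ∑ y ∈ Fintype.piFinset (fun _ : Fin 3 => Finset.Ico (0:ℤ) (L:ℤ)), criticalTwoPoint 3 (y - x))|
      ≤ C * (L : ℝ) ^ (-θ)

/-- Statement of `stub_lambdaRate`. -/
def LambdaRate : Prop :=
    DCR →
    ∃ θ C : ℝ, 0 < θ ∧ ∀ L : ℕ, 1 ≤ L →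
      8 ≤ (∑ x ∈ Fintype.piFinset (fun _ : Fin 3 => Finset.Ico (0:ℤ) (2 * (L:ℤ))),
              ∑ y ∈ Fintype.piFinset (fun _ : Fin 3 => Finset.Ico (0:ℤ) (2 * (L:ℤ))), criticalTwoPoint 3 (y - x)) /
            (∑ x ∈ Fintype.piFinset (fun _ : Fin 3 => Finset.Ico (0:ℤ) (L:ℤ)),
              ∑ y ∈ Fintype.piFinset (fun _ : Fin 3 => Finset.Ico (0:ℤ) (L:ℤ)), criticalTwoPoint 3 (y - x)) ∧
      |(∑ x ∈ Fintype.piFinset (fun _ : Fin 3 => Finset.Ico (0:ℤ) (4 * (L:ℤ))),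
          ∑ y ∈ Fintype.piFinset (fun _ : Fin 3 => Finset.Ico (0:ℤ) (4 * (L:ℤ))), criticalTwoPoint 3 (y - x)) /
        (∑ x ∈ Fintype.piFinset (fun _ : Fin 3 => Finset.Ico (0:ℤ) (2 * (L:ℤ))),
          ∑ y ∈ Fintype.piFinset (fun _ : Fin 3 => Finset.Ico (0:ℤ) (2 * (L:ℤ))), criticalTwoPoint 3 (y - x)) -
       (∑ x ∈ Fintype.piFinset (fun _ : Fin 3 => Finset.Ico (0:ℤ) (2 * (L:ℤ))),
          ∑ y ∈ Fintype.piFinset (fun _ : Fin 3 => Finset.Ico (0:ℤ) (2 * (L:ℤ))), criticalTwoPoint 3 (y - x)) /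
        (∑ x ∈ Fintype.piFinset (fun _ : Fin 3 => Finset.Ico (0:ℤ) (L:ℤ)),
          ∑ y ∈ Fintype.piFinset (fun _ : Fin 3 => Finset.Ico (0:ℤ) (L:ℤ)), criticalTwoPoint 3 (y - x))|
      ≤ C * (L : ℝ) ^ (-θ)

/-- Statement of `stub_blockVarianceBounds`. -/
def BlockVarianceBounds : Prop :=
    ∃ c : ℝ, 0 < c ∧ ∀ L : ℕ, 1 ≤ L →
      c * (L : ℝ) ^ 4 ≤
          (∑ x ∈ Fintype.piFinset (fun _ : Fin 3 => Finset.Ico (0:ℤ) (L:ℤ)),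
            ∑ y ∈ Fintype.piFinset (fun _ : Fin 3 => Finset.Ico (0:ℤ) (L:ℤ)), criticalTwoPoint 3 (y - x)) ∧
        (∑ x ∈ Fintype.piFinset (fun _ : Fin 3 => Finset.Ico (0:ℤ) (L:ℤ)),
            ∑ y ∈ Fintype.piFinset (fun _ : Fin 3 => Finset.Ico (0:ℤ) (L:ℤ)), criticalTwoPoint 3 (y - x)) ≤
          (L : ℝ) ^ 6 ∧
        (L : ℝ) ^ 6 * criticalTwoPoint 3 (Pi.single 0 ((3 * L : ℕ) : ℤ)) ≤
          (∑ x ∈ Fintype.piFinset (fun _ : Fin 3 => Finset.Ico (0:ℤ) (L:ℤ)),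
            ∑ y ∈ Fintype.piFinset (fun _ : Fin 3 => Finset.Ico (0:ℤ) (L:ℤ)), criticalTwoPoint 3 (y - x))

/-- Statement of `stub_octaveTelescoping`. -/
def Telescoping : Prop :=
    ∀ (v : ℕ → ℝ) (m θ C : ℝ), 0 < m → 0 < θ →
      (∀ k : ℕ, 0 < v k) → (∀ k : ℕ, m ≤ v (k + 1) / v k) →
      (∀ k : ℕ, |v (k + 2) / v (k + 1) - v (k + 1) / v k| ≤ C * ((2:ℝ) ^ k) ^ (-θ)) →
      ∃ Λ A₁ A₂ : ℝ, m ≤ Λ ∧ 0 < A₁ ∧ ∀ k : ℕ, A₁ * Λ ^ k ≤ v k ∧ v k ≤ A₂ * Λ ^ k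

/-- Statement of `stub_lowerEnvelope`. -/
def LowerEnvelope : Prop :=
    ∀ (s A B : ℝ), 0 ≤ s → s ≤ 2 → 0 < A →
      (∀ k : ℕ, A * ((2:ℝ) ^ k) ^ ((6:ℝ) - s) ≤
        ∑ x ∈ Fintype.piFinset (fun _ : Fin 3 => Finset.Ico (0:ℤ) (2 ^ k)),
          ∑ y ∈ Fintype.piFinset (fun _ : Fin 3 => Finset.Ico (0:ℤ) (2 ^ k)), criticalTwoPoint 3 (y - x)) →
      (∀ n : ℕ, 1 ≤ n → criticalTwoPoint 3 (Pi.single 0 (n : ℤ)) ≤ B * (n : ℝ) ^ (-s)) →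
      ∃ c : ℝ, 0 < c ∧ ∀ n : ℕ, 1 ≤ n → c * (n : ℝ) ^ (-s) ≤ criticalTwoPoint 3 (Pi.single 0 (n : ℤ))

/-! ### Proved glue (pure real analysis + the MMS sphere sandwich) -/

namespace Glue

/-- If `a x^k ≤ B y^k` for all `k` with `a, x, y > 0`, then `x ≤ y`. [folklore] -/
theorem le_of_forall_mul_pow_le {a B x y : ℝ} (ha : 0 < a) (hy : 0 < y)
    (h : ∀ k : ℕ, a * x ^ k ≤ B * y ^ k) : x ≤ y := by
  by_contra hlt
  push Not at hlt
  have hr : 1 < x / y := (one_lt_div hy).2 hlt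
  have ht : Tendsto (fun k : ℕ => a * (x / y) ^ k) atTop atTop :=
    Tendsto.const_mul_atTop ha (tendsto_pow_atTop_atTop_of_one_lt hr)
  obtain ⟨k, hk⟩ := (ht.eventually_gt_atTop B).exists
  have hyk : 0 < y ^ k := pow_pos hy k
  have hk' : a * (x / y) ^ k ≤ B := by
    rw [div_pow, ← mul_div_assoc, div_le_iff₀ hyk]
    exact h k
  linarith

/-- `Λ^k = (2^k)^{log₂ Λ}` for `Λ > 0`. [folklore] -/
theorem pow_eq_two_pow_rpow_logb {Λ : ℝ} (hΛ : 0 < Λ) (k : ℕ) :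
    Λ ^ k = ((2:ℝ) ^ k) ^ (Real.logb 2 Λ) := by
  rw [← Real.rpow_natCast (2:ℝ) k, ← Real.rpow_mul (by norm_num : (0:ℝ) ≤ 2), mul_comm,
    Real.rpow_mul (by norm_num : (0:ℝ) ≤ 2), Real.rpow_logb two_pos (by norm_num) hΛ,
    Real.rpow_natCast]

/-- `log₂ (2^n) = n`. [folklore] -/
theorem logb_two_pow (n : ℕ) : Real.logb 2 ((2:ℝ) ^ n) = n := by
  rw [Real.logb_pow, Real.logb_self_eq_one one_lt_two, mul_one]

/-- **Dyadic fill-in of an upper envelope.** A positive antitone `g ≤ 1` with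
`g(3·2^k) ≤ B (2^k)^{-s}` (`s ≥ 0`) satisfies `g n ≤ C n^{-s}` for `n ≥ 1`. [folklore] -/
theorem upper_fill {g : ℕ → ℝ} (hpos : ∀ n, 0 < g n) (hanti : Antitone g) (hle1 : ∀ n, g n ≤ 1)
    {s B : ℝ} (hs : 0 ≤ s) (h : ∀ k : ℕ, g (3 * 2 ^ k) ≤ B * ((2:ℝ) ^ k) ^ (-s)) :
    ∃ C : ℝ, ∀ n : ℕ, 1 ≤ n → g n ≤ C * (n : ℝ) ^ (-s) := by
  have hB : 0 ≤ B := by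
    have h0 := (hpos (3 * 2 ^ 0)).trans_le (h 0)
    simp at h0
    exact h0.le
  refine ⟨max (B * (6:ℝ) ^ s) ((2:ℝ) ^ s), fun n hn => ?_⟩
  have hnpos : (0:ℝ) < n := by exact_mod_cast (show 0 < n by omega)
  have hns : 0 ≤ (n:ℝ) ^ (-s) := Real.rpow_nonneg hnpos.le _
  rcases lt_or_ge n 3 with hn3 | hn3
  · -- n ∈ {1, 2}: g n ≤ 1 ≤ 2^s n^{-s}
    have h2 : (1:ℝ) ≤ (2:ℝ) ^ s * (n:ℝ) ^ (-s) := by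
      have hle : (n:ℝ) ≤ 2 := by exact_mod_cast (show n ≤ 2 by omega)
      have h1 : (2:ℝ) ^ (-s) ≤ (n:ℝ) ^ (-s) :=
        Real.rpow_le_rpow_of_nonpos hnpos hle (neg_nonpos.2 hs)
      have h22 : (2:ℝ) ^ s * (2:ℝ) ^ (-s) = 1 := by
        rw [← Real.rpow_add two_pos, add_neg_cancel, Real.rpow_zero]
      calc (1:ℝ) = (2:ℝ) ^ s * (2:ℝ) ^ (-s) := h22.symm
        _ ≤ (2:ℝ) ^ s * (n:ℝ) ^ (-s) := mul_le_mul_of_nonneg_left h1 (by positivity)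
    calc g n ≤ 1 := hle1 n
      _ ≤ (2:ℝ) ^ s * (n:ℝ) ^ (-s) := h2
      _ ≤ max (B * (6:ℝ) ^ s) ((2:ℝ) ^ s) * (n:ℝ) ^ (-s) :=
          mul_le_mul_of_nonneg_right (le_max_right _ _) hns
  · set k := Nat.log 2 (n / 3) with hk
    have hq : n / 3 ≠ 0 := by omega
    have h1 : 2 ^ k ≤ n / 3 := Nat.pow_log_le_self 2 hq
    have h2 : n / 3 < 2 ^ (k + 1) := Nat.lt_pow_succ_log_self (by norm_num) _
    have h3 : 3 * 2 ^ k ≤ n := by omega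
    have h4 : n < 6 * 2 ^ k := by
      have : 2 ^ (k + 1) = 2 * 2 ^ k := by ring
      omega
    have h2k : (0:ℝ) < (2:ℝ) ^ k := by positivity
    have hle : (n:ℝ) ≤ 6 * (2:ℝ) ^ k := by exact_mod_cast h4.le
    have hcmp : ((6:ℝ) * (2:ℝ) ^ k) ^ (-s) ≤ (n:ℝ) ^ (-s) :=
      Real.rpow_le_rpow_of_nonpos hnpos hle (neg_nonpos.2 hs)
    have hsplit : ((6:ℝ) * (2:ℝ) ^ k) ^ (-s) = (6:ℝ) ^ (-s) * ((2:ℝ) ^ k) ^ (-s) :=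
      Real.mul_rpow (by norm_num) h2k.le
    have h66 : (6:ℝ) ^ s * (6:ℝ) ^ (-s) = 1 := by
      rw [← Real.rpow_add (by norm_num : (0:ℝ) < 6), add_neg_cancel, Real.rpow_zero]
    calc g n ≤ g (3 * 2 ^ k) := hanti h3
      _ ≤ B * ((2:ℝ) ^ k) ^ (-s) := h k
      _ = B * (6:ℝ) ^ s * ((6:ℝ) * (2:ℝ) ^ k) ^ (-s) := by
          rw [hsplit, show B * (6:ℝ) ^ s * ((6:ℝ) ^ (-s) * ((2:ℝ) ^ k) ^ (-s)) =
            B * ((6:ℝ) ^ s * (6:ℝ) ^ (-s)) * ((2:ℝ) ^ k) ^ (-s) by ring, h66, mul_one]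
      _ ≤ B * (6:ℝ) ^ s * (n:ℝ) ^ (-s) := mul_le_mul_of_nonneg_left hcmp (by positivity)
      _ ≤ max (B * (6:ℝ) ^ s) ((2:ℝ) ^ s) * (n:ℝ) ^ (-s) :=
          mul_le_mul_of_nonneg_right (le_max_left _ _) hns

/-- **The analytic core of the line, abstractly.** For a positive sequence `v` (block variances along
`2^k`) with octave ratios `≥ 8`, a power rate on consecutive octave ratios, a priori
`c 16^k ≤ v k ≤ 64^k`, and a positive antitone `g ≤ 1` with `(2^k)^6 g(3·2^k) ≤ v k`, the telescoping
statement and the lower-envelope statement yield two-sided power bounds for `g`. [folklore] -/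
theorem axis_bounds_core (v g : ℕ → ℝ) {θ C c : ℝ} (hθ : 0 < θ) (hc : 0 < c)
    (hv8 : ∀ k : ℕ, 8 ≤ v (k + 1) / v k)
    (hvrate : ∀ k : ℕ, |v (k + 2) / v (k + 1) - v (k + 1) / v k| ≤ C * ((2:ℝ) ^ k) ^ (-θ))
    (hvlo : ∀ k : ℕ, c * ((2:ℝ) ^ k) ^ 4 ≤ v k) (hvhi : ∀ k : ℕ, v k ≤ ((2:ℝ) ^ k) ^ 6)
    (hvg : ∀ k : ℕ, ((2:ℝ) ^ k) ^ 6 * g (3 * 2 ^ k) ≤ v k)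
    (hgpos : ∀ n, 0 < g n) (hganti : Antitone g) (hgle1 : ∀ n, g n ≤ 1)
    (h4 : ∀ (v : ℕ → ℝ) (m θ C : ℝ), 0 < m → 0 < θ →
      (∀ k : ℕ, 0 < v k) → (∀ k : ℕ, m ≤ v (k + 1) / v k) →
      (∀ k : ℕ, |v (k + 2) / v (k + 1) - v (k + 1) / v k| ≤ C * ((2:ℝ) ^ k) ^ (-θ)) →
      ∃ Λ A₁ A₂ : ℝ, m ≤ Λ ∧ 0 < A₁ ∧ ∀ k : ℕ, A₁ * Λ ^ k ≤ v k ∧ v k ≤ A₂ * Λ ^ k)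
    (h5 : ∀ (s A B : ℝ), 0 ≤ s → s ≤ 2 → 0 < A →
      (∀ k : ℕ, A * ((2:ℝ) ^ k) ^ ((6:ℝ) - s) ≤ v k) →
      (∀ n : ℕ, 1 ≤ n → g n ≤ B * (n : ℝ) ^ (-s)) →
      ∃ c : ℝ, 0 < c ∧ ∀ n : ℕ, 1 ≤ n → c * (n : ℝ) ^ (-s) ≤ g n) :
    ∃ s c' C' : ℝ, 0 < c' ∧ ∀ n : ℕ, 1 ≤ n → c' * (n : ℝ) ^ (-s) ≤ g n ∧ g n ≤ C' * (n : ℝ) ^ (-s) := by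
  have hvpos : ∀ k, 0 < v k := fun k => lt_of_lt_of_le (by positivity) (hvlo k)
  obtain ⟨Λ, A₁, A₂, hΛ8, hA₁, hΛ⟩ := h4 v 8 θ C (by norm_num) hθ hvpos hv8 hvrate
  have hΛpos : 0 < Λ := by linarith
  -- `Λ ∈ [16, 64]` from the a priori window
  have h16 : (16:ℝ) ≤ Λ := by
    refine le_of_forall_mul_pow_le hc hΛpos (B := A₂) fun k => ?_
    calc c * (16:ℝ) ^ k = c * ((2:ℝ) ^ k) ^ 4 := by
          rw [← pow_mul, mul_comm k 4, pow_mul]; norm_num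
      _ ≤ v k := hvlo k
      _ ≤ A₂ * Λ ^ k := (hΛ k).2
  have h64 : Λ ≤ 64 := by
    refine le_of_forall_mul_pow_le hA₁ (by norm_num) (B := 1) fun k => ?_
    calc A₁ * Λ ^ k ≤ v k := (hΛ k).1
      _ ≤ ((2:ℝ) ^ k) ^ 6 := hvhi k
      _ = 1 * (64:ℝ) ^ k := by
          rw [one_mul, ← pow_mul, mul_comm k 6, pow_mul]; norm_num
  -- the exponent
  set s : ℝ := 6 - Real.logb 2 Λ with hs
  have hlog16 : (4:ℝ) ≤ Real.logb 2 Λ := by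
    have h := Real.logb_le_logb_of_le one_lt_two (by norm_num) h16
    rwa [show (16:ℝ) = (2:ℝ) ^ (4:ℕ) by norm_num, logb_two_pow] at h
  have hlog64 : Real.logb 2 Λ ≤ 6 := by
    have h := Real.logb_le_logb_of_le one_lt_two hΛpos h64
    rwa [show (64:ℝ) = (2:ℝ) ^ (6:ℕ) by norm_num, logb_two_pow] at h
  have hs0 : 0 ≤ s := by simp only [hs]; linarith
  have hs2 : s ≤ 2 := by simp only [hs]; linarith
  have hΛk : ∀ k : ℕ, Λ ^ k = ((2:ℝ) ^ k) ^ ((6:ℝ) - s) := fun k => by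
    rw [show (6:ℝ) - s = Real.logb 2 Λ by simp only [hs]; ring]
    exact pow_eq_two_pow_rpow_logb hΛpos k
  -- upper envelope along `3·2^k`, then everywhere
  have hA₂ : 0 ≤ A₂ := by
    have h0 := (hvpos 0).trans_le (hΛ 0).2
    simp at h0
    exact h0.le
  have hup3 : ∀ k : ℕ, g (3 * 2 ^ k) ≤ A₂ * ((2:ℝ) ^ k) ^ (-s) := by
    intro k
    have h2k : (0:ℝ) < (2:ℝ) ^ k := by positivity
    have h6 : (0:ℝ) < ((2:ℝ) ^ k) ^ 6 := by positivity
    have h := (hvg k).trans ((hΛ k).2)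
    rw [hΛk k, show (6:ℝ) - s = 6 + (-s) by ring, Real.rpow_add h2k,
      show ((2:ℝ) ^ k) ^ (6:ℝ) = ((2:ℝ) ^ k) ^ (6:ℕ) from Real.rpow_natCast _ 6] at h
    -- `(2^k)^6 g ≤ A₂ (2^k)^6 (2^k)^{-s}`
    have h' : ((2:ℝ) ^ k) ^ 6 * g (3 * 2 ^ k) ≤ ((2:ℝ) ^ k) ^ 6 * (A₂ * ((2:ℝ) ^ k) ^ (-s)) := by
      calc ((2:ℝ) ^ k) ^ 6 * g (3 * 2 ^ k) ≤ A₂ * (((2:ℝ) ^ k) ^ 6 * ((2:ℝ) ^ k) ^ (-s)) := h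
        _ = ((2:ℝ) ^ k) ^ 6 * (A₂ * ((2:ℝ) ^ k) ^ (-s)) := by ring
    exact le_of_mul_le_mul_left h' h6
  obtain ⟨B, hB⟩ := upper_fill hgpos hganti hgle1 hs0 hup3
  -- lower envelope from the stub
  obtain ⟨c', hc', hlow⟩ := h5 s A₁ B hs0 hs2 hA₁ (fun k => by rw [← hΛk k]; exact (hΛ k).1) hB
  exact ⟨s, c', B, hc', fun n hn => ⟨hlow n hn, hB n hn⟩⟩

/-- **Two-sided axis bounds ⟹ the crux** (Messager–Miracle-Solé sphere sandwich; this is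
`CensusWeb.dimensionPinned_of_axisPinned`, re-proved because crux workfiles are not importable). -/
theorem dimensionPinned_of_axis_bounds {s c C : ℝ} (hc : 0 < c)
    (hb : ∀ n : ℕ, 1 ≤ n → c * (n : ℝ) ^ (-s) ≤ criticalTwoPoint 3 (Pi.single 0 (n : ℤ)) ∧
      criticalTwoPoint 3 (Pi.single 0 (n : ℤ)) ≤ C * (n : ℝ) ^ (-s)) :
    DimensionPinned := by
  refine ⟨s - (((3 : ℕ) : ℝ) - 2), c * (3 : ℝ) ^ (-s), C, by positivity, fun x hx => ?_⟩
  have hexp : ((3 : ℕ) : ℝ) - 2 + (s - (((3 : ℕ) : ℝ) - 2)) = s := by ring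
  rw [hexp]
  set n := Site.supNorm x with hn
  have hn1 : 1 ≤ n := Nat.one_le_iff_ne_zero.2 fun h0 => hx (Site.supNorm_eq_zero_iff.1 h0)
  have hnorm : ‖x‖ = (n : ℝ) := Site.norm_eq_supNorm x
  obtain ⟨hlo, hhi⟩ := criticalTwoPoint_axis_sandwich (y := x) hn1
  have h3n := (hb (3 * n) (by omega)).1
  have hn' := (hb n hn1).2
  rw [hnorm]
  constructor
  · calc c * (3 : ℝ) ^ (-s) * ((n : ℝ)) ^ (-s) = c * (((3 * n : ℕ) : ℝ)) ^ (-s) := by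
          rw [Nat.cast_mul, Nat.cast_ofNat, Real.mul_rpow (by norm_num) (Nat.cast_nonneg n)]
          ring
      _ ≤ criticalTwoPoint 3 (Pi.single 0 (((3 * n : ℕ)) : ℤ)) := h3n
      _ ≤ criticalTwoPoint 3 x := hlo
  · calc criticalTwoPoint 3 x ≤ criticalTwoPoint 3 (Pi.single 0 (n : ℤ)) := hhi
      _ ≤ C * (n : ℝ) ^ (-s) := hn'

end Glue

/-- **The composition of the line**: DCR₂₇ and the four analytic stubs give the crux BY NAME. -/
theorem DimensionPinned_of (h1 : DCR) (h2 : LambdaRate) (h3 : BlockVarianceBounds)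
    (h4 : Telescoping) (h5 : LowerEnvelope) : DimensionPinned := by
  obtain ⟨θ, C, hθ, hrate⟩ := h2 h1
  obtain ⟨c, hc, hbnd⟩ := h3
  -- the dyadic block variances and the axis two-point function
  let v : ℕ → ℝ := fun k =>
    ∑ x ∈ Fintype.piFinset (fun _ : Fin 3 => Finset.Ico (0:ℤ) (2 ^ k)),
      ∑ y ∈ Fintype.piFinset (fun _ : Fin 3 => Finset.Ico (0:ℤ) (2 ^ k)), criticalTwoPoint 3 (y - x)
  let g : ℕ → ℝ := fun n => criticalTwoPoint 3 (Pi.single 0 (n : ℤ))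
  have hv8 : ∀ k : ℕ, 8 ≤ v (k + 1) / v k := by
    intro k
    have h := (hrate (2 ^ k) Nat.one_le_two_pow).1
    simp only [Nat.cast_pow, Nat.cast_ofNat] at h
    rw [show (2:ℤ) * 2 ^ k = 2 ^ (k + 1) by ring] at h
    exact h
  have hvrate : ∀ k : ℕ, |v (k + 2) / v (k + 1) - v (k + 1) / v k| ≤ C * ((2:ℝ) ^ k) ^ (-θ) := by
    intro k
    have h := (hrate (2 ^ k) Nat.one_le_two_pow).2
    simp only [Nat.cast_pow, Nat.cast_ofNat] at h
    rw [show (2:ℤ) * 2 ^ k = 2 ^ (k + 1) by ring, show (4:ℤ) * 2 ^ k = 2 ^ (k + 2) by ring] at h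
    exact h
  have hvlo : ∀ k : ℕ, c * ((2:ℝ) ^ k) ^ 4 ≤ v k := by
    intro k
    have h := (hbnd (2 ^ k) Nat.one_le_two_pow).1
    simp only [Nat.cast_pow, Nat.cast_ofNat] at h
    exact h
  have hvhi : ∀ k : ℕ, v k ≤ ((2:ℝ) ^ k) ^ 6 := by
    intro k
    have h := (hbnd (2 ^ k) Nat.one_le_two_pow).2.1
    simp only [Nat.cast_pow, Nat.cast_ofNat] at h
    exact h
  have hvg : ∀ k : ℕ, ((2:ℝ) ^ k) ^ 6 * g (3 * 2 ^ k) ≤ v k := by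
    intro k
    have h := (hbnd (2 ^ k) Nat.one_le_two_pow).2.2
    simp only [Nat.cast_pow, Nat.cast_ofNat] at h
    exact h
  have hgpos : ∀ n, 0 < g n := fun n => criticalTwoPoint_axis_pos n
  have hganti : Antitone g := fun _ _ h => criticalTwoPoint_axis_antitone h
  have hgle1 : ∀ n, g n ≤ 1 := fun n => criticalTwoPoint_le_one' _
  obtain ⟨s, c', C', hc', hb⟩ :=
    Glue.axis_bounds_core v g hθ hc hv8 hvrate hvlo hvhi hvg hgpos hganti hgle1 h4 h5
  exact Glue.dimensionPinned_of_axis_bounds hc' hb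

/-- **stub 7 — the transfer `DCR₂₇ → DimensionPinned`** (to be proved below from stubs 2–5). -/
theorem stub_transfer :
    (∃ θ C : ℝ, 0 < θ ∧ ∀ L : ℕ, 1 ≤ L → ∀ u : Fin 3 → ℤ, (∀ i, |u i| ≤ 1) →
      |(∑ x ∈ Fintype.piFinset (fun _ : Fin 3 => Finset.Ico (0:ℤ) (2 * (L:ℤ))),
          ∑ y ∈ Fintype.piFinset (fun i : Fin 3 => Finset.Ico (2 * (L:ℤ) * u i) (2 * (L:ℤ) * u i + 2 * (L:ℤ))),
            criticalTwoPoint 3 (y - x)) /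
        (∑ x ∈ Fintype.piFinset (fun _ : Fin 3 => Finset.Ico (0:ℤ) (2 * (L:ℤ))),
          ∑ y ∈ Fintype.piFinset (fun _ : Fin 3 => Finset.Ico (0:ℤ) (2 * (L:ℤ))), criticalTwoPoint 3 (y - x)) -
       (∑ x ∈ Fintype.piFinset (fun _ : Fin 3 => Finset.Ico (0:ℤ) (L:ℤ)),
          ∑ y ∈ Fintype.piFinset (fun i : Fin 3 => Finset.Ico ((L:ℤ) * u i) ((L:ℤ) * u i + (L:ℤ))),
            criticalTwoPoint 3 (y - x)) /
        (∑ x ∈ Fintype.piFinset (fun _ : Fin 3 => Finset.Ico (0:ℤ) (L:ℤ)),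
          ∑ y ∈ Fintype.piFinset (fun _ : Fin 3 => Finset.Ico (0:ℤ) (L:ℤ)), criticalTwoPoint 3 (y - x))|
      ≤ C * (L : ℝ) ^ (-θ)) →
    DimensionPinned :=
  fun h1 => DimensionPinned_of h1 stub_lambdaRate stub_blockVarianceBounds stub_octaveTelescoping
    stub_lowerEnvelope

/-! ### Composition -/

/-- The crux BY NAME (the item's home decl `ClusterRigidity.DimensionPinned`; the three route decls
`ClusterRigidity.DimensionPinned`, `CoerciveSharpness.DimensionPinned`, `HelsonAxis.EtaBoundsExist` of the
shared item stmt-CriticalPhenomena-4662 are the same term) from the open input and the transfer. -/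
theorem DimensionPinned_proof :
    Summit.CriticalPhenomena.Ising3DConformalLimit.Theses.ClusterRigidity.DimensionPinned :=
  stub_transfer stub_dilationCovarianceRate

/-- The same, typed as the bet route's decl `CoerciveSharpness.DimensionPinned`. -/
theorem DimensionPinned_proof_coerciveSharpness : DimensionPinned :=
  stub_transfer stub_dilationCovarianceRate

/-- The same, typed as `HelsonAxis.EtaBoundsExist`. -/
theorem EtaBoundsExist_proof :
    Summit.CriticalPhenomena.Ising3DConformalLimit.Theses.HelsonAxis.EtaBoundsExist :=
  stub_transfer stub_dilationCovarianceRate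

/-- The crux from item stmt-CriticalPhenomena-18762 through the dock (LANDED as
`Theorems.CoerciveSharpnessDimensionPinned.dimensionPinned_of_dilationJoinings`, p162260). -/
theorem DimensionPinned_of_dilationJoinings (h : DilationJoinings) : DimensionPinned :=
  stub_transfer (stub_dock h)

/-- **Pointwise port** (registered stub `stub_pointwiseTransfer`, LANDED p162779 as
`Theorems/CoerciveSharpnessDimensionPinnedPointwiseTransfer.lean`): a power rate for the second dyadic
differences of `log g(2^k)` (OctaveRatioRate) already gives the crux — the dock for pointwise rate engines. -/
theorem stub_pointwiseTransfer :
    (∃ θ C : ℝ, 0 < θ ∧ ∀ k : ℕ,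
      |Real.log (criticalTwoPoint 3 (Pi.single 0 ((2 ^ (k + 2) : ℕ) : ℤ))) -
          2 * Real.log (criticalTwoPoint 3 (Pi.single 0 ((2 ^ (k + 1) : ℕ) : ℤ))) +
        Real.log (criticalTwoPoint 3 (Pi.single 0 ((2 ^ k : ℕ) : ℤ)))| ≤ C * ((2:ℝ) ^ k) ^ (-θ)) →
    DimensionPinned :=
  Summit.CriticalPhenomena.Ising3DConformalLimit.Theorems.CoerciveSharpnessDimensionPinned.stub_pointwiseTransfer

/-- **Weakest consumed input** (registered stub `stub_varianceTransfer`, LANDED p163212 as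
`Theorems/CoerciveSharpnessDimensionPinnedVarianceTransfer.lean`): a power rate for the octave ratio of the
block-spin VARIANCES alone (VarianceRatioRate) already gives the crux; DCR₂₇ ⟹ VarianceRatioRate is the
second component of `stub_lambdaRate`.  This is the statement to promote if the crux's residual open content
is to become its own item. -/
theorem stub_varianceTransfer :
    (∃ θ C : ℝ, 0 < θ ∧ ∀ L : ℕ, 1 ≤ L →
      |(∑ x ∈ Fintype.piFinset (fun _ : Fin 3 => Finset.Ico (0:ℤ) (4 * (L:ℤ))),
          ∑ y ∈ Fintype.piFinset (fun _ : Fin 3 => Finset.Ico (0:ℤ) (4 * (L:ℤ))), criticalTwoPoint 3 (y - x)) /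
        (∑ x ∈ Fintype.piFinset (fun _ : Fin 3 => Finset.Ico (0:ℤ) (2 * (L:ℤ))),
          ∑ y ∈ Fintype.piFinset (fun _ : Fin 3 => Finset.Ico (0:ℤ) (2 * (L:ℤ))), criticalTwoPoint 3 (y - x)) -
       (∑ x ∈ Fintype.piFinset (fun _ : Fin 3 => Finset.Ico (0:ℤ) (2 * (L:ℤ))),
          ∑ y ∈ Fintype.piFinset (fun _ : Fin 3 => Finset.Ico (0:ℤ) (2 * (L:ℤ))), criticalTwoPoint 3 (y - x)) /
        (∑ x ∈ Fintype.piFinset (fun _ : Fin 3 => Finset.Ico (0:ℤ) (L:ℤ)),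
          ∑ y ∈ Fintype.piFinset (fun _ : Fin 3 => Finset.Ico (0:ℤ) (L:ℤ)), criticalTwoPoint 3 (y - x))|
      ≤ C * (L : ℝ) ^ (-θ)) →
    DimensionPinned :=
  Summit.CriticalPhenomena.Ising3DConformalLimit.Theorems.CoerciveSharpnessDimensionPinned.stub_varianceTransfer

end Summit.CriticalPhenomena.Ising3DConformalLimit.Cruxes.DimensionPinned.OctaveTelescoping
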